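import Summits.FinalStateConjecture.FinalStateConjecture.Theses.StarvedNecks
import Summits.FinalStateConjecture.FinalStateConjecture.Theorems.SeamedChartsExhaust.Negative.ReversedFlatChart
import Literature.Geometry.Lorentzian.CausalityPushUp
import Literature.Geometry.Lorentzian.CausalFutureProofs
import Literature.Geometry.Lorentzian.MinkowskiGlobalHyperbolicity
import Literature.Geometry.Lorentzian.KerrConvergenceProofs
import HarnessLib.Audit

/-!
# Line `rim-criterion` — skeleton for crux `StarvedNecks.SeamedChartsExhaust`
(item stmt-FinalStateConjecture-13551, route `route-FinalStateConjecture-StarvedNecks`; crux-plan seat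
`planner-cruxplan-stmt-FinalStateConjecture-13551-rim-criterion-0`, 2026-08-16; line card `Lines/rim-criterion.md`).

The crux: for every admissible datum, MGHD `𝒟`, region `O`, `C²` decomposition `d`, radii `R`, `R₀`,
`O = exteriorOf 𝒟 d.charted ∧ HonestCore(d, R₀) ∧ SEAMED(d, R, R₀) → HasExhaustiveCharts d`.
Clause (i) of `HasExhaustiveCharts` is SEAMED (2) verbatim; clause (ii) is
`O \ F ⊆ J⁻(S)` with `F = certifiedLate d R τ₁`, `S = certifiedSlab d R τ₁`, for every `τ₁ > τ₀`.

## The line (idea card `Ideas/rim-criterion.md`, triage `TRIAGE-r1-{1,2,3}.md`: pass ×3)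

LEVER (proved here, `rim_criterion`, copied from the ideator's `SketchIdeator1.rimCriterion_holds`):
in any spacetime, for sets `O, F, S`: (V) `O` diamond-convex, (R) every `p ∈ O` causally precedes some
`q ∈ O` with `q ∈ F ∨ q ∈ J⁻ S`, (RIM) `frontier F ∩ O ⊆ J⁻ S` ⟹ `O \ F ⊆ J⁻ S` (first entry of a
causal curve into `closure F`, an `sInf` over a closed subset of `Icc a b`; no limit curves).
(V) and cofinality `O ⊆ I⁻(d.charted)` hold for `exteriorOf` (proved: `exteriorOf_diamond`,
`exteriorOf_cofinal`); `F` is OPEN under SEAMED (proved: `isOpen_certifiedLate`, copied from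
`SketchIdeator3.certifiedLateIsOpen_holds` — lateral walls `r = Rⱼ(t)`, `t > τ₁` are flat-late interior
points by SEAMED (6) ⇐ (9), (8), (12)), so `frontier F = closure F \ F`.
What remains is chart bookkeeping, cut into FOUR registered stubs keyed to disjoint clause groups
(triage sharpenings T1–T3: RIM in the form `(closure F ∩ O) \ F`, the ride as ONE shared lemma, the
flat ray stopped at FIRST CONTACT with the closed certified tubes, routing separated from flows):

* `stub_rim`         — RIM ENUMERATION: `(closure F ∩ O) \ F ⊆ S ∪ T` where `T` = the ride-able
                       certified tube points (hole time `≤ τ₁`, `R₀ ≤ r ≤ Rⱼ(t)`, hole-late or flat-late).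
                       Clauses: SEAMED (11) [closure of the flat piece = flat points ∪ flat-tube walls],
                       HonestCore (c) with the continuous profile `ϱ := Rⱼ` [closure of the hole pieces],
                       SEAMED (1) [`R₀ ≤ ρ`, `R` continuous], SEAMED (8) [walls lie deep in certified tubes].
* `stub_tubeRide`    — THE RIDE: `T ⊆ J⁻ S` — the `Λⱼe₀`-segment at constant rest-frame radius is a
                       future causal curve (SEAMED (5), orthochronous `Λⱼ` = HonestCore (a), `R` monotone
                       = SEAMED (1)) landing on the disc `{t = τ₁, r ≤ Rⱼ(τ₁)} ⊆ S`.
* `stub_flatBoarding`— FLAT BOARDING: a flat-late point with flat time in `(τ₀, τ₁]` lies in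
                       `J⁻(S ∪ T)`: the `e₀`-ray (HonestCore (d)) up to the flat slab or to FIRST CONTACT
                       with the closed set `⋃ₖ {rₖ ≤ Rₖ(tₖ)}`, where one atlas (SEAMED (6) ⇐ (7), (8), (9),
                       (1), `100M ≤ R₀` of HonestCore (a)) makes the contact point a point of `T`.
* `stub_holeRouting` — ROUTING (flow-free enumeration): an uncertified hole-late point is on `S`, or
                       anchorable (`t < τ₁`, `r < Rᵢ(τ₁)`), or equal to a flat-late point with flat time in
                       `(τ₀, τ₁]` (collar: SEAMED (9), (8), (12), (6); far leaf: SEAMED (10); (1) monotone).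

COMPOSITION (`SeamedChartsExhaust_of`, sorry-free apart from the four stubs it invokes; concludes the
crux BY NAME): REACH `d.charted \ F ⊆ J⁻ S` from routing + anchoring (HonestCore (b) at `ϱ := Rᵢ(τ₁)`,
proved: `hole_anchoring`) + boarding + ride; RIM from openness + `stub_rim` + ride; then `rim_criterion`
with (V), cofinality and `J⁻ ∘ J⁻ = J⁻` (`causalFuture_causalFuture_eq`).

## Disproof / negatives honoured
`Cruxes/SeamedChartsExhaust/Disproof.lean` (cdisprove v1: crux RESISTS): §3 `not_withoutFutureOrientation`,
landed as `Theorems/SeamedChartsExhaust/Negative/WithoutFutureOrientation.lean`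
(`Negative.not_forall_hasExhaustiveCharts_without_futureOrientation`; its model `Negative/ReversedFlatChart.lean`,
`ReversedModel.not_hasExhaustiveCharts_decomp`, is imported below — the corollary module was not yet served by the
check farm at planning time): HonestCore (d) is
load-bearing — THIS LINE USES (d) AT `stub_flatBoarding` (hypothesis `hd`), and only there; the other
three stubs are (d)-free and hold in the reversed model (vacuously for `N = 0` or by SEAMED (11)).
§2 `seamedChartsExhaust_of_core`: sub-extremality, SEAMED (3), (4) and `100M ≤ R₀` beyond `r₊ < R₀` are
decorative — consistent: no stub consumes `Kerr.IsSubextremal`, (3) or (4); `100M ≤ R₀` enters only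
`stub_flatBoarding` (contact points lie in the chart domain `{r > max r₊ 0}`). §4 `line_mem_causalFuture`
(coordinate lines through a chart are causal curves; clamped parameter) is the adapter both flow stubs
need — provers copy it verbatim. `ledger negatives --problem FinalStateConjecture`: 0 (2026-08-16).
-/

noncomputable section

open Set Filter Function Topology TopologicalSpace
open scoped Manifold ContDiff ENNReal Topology
open Literature.Geometry.Lorentzian

set_option linter.dupNamespace false

namespace Summit.FinalStateConjecture.FinalStateConjecture.Cruxes.SeamedChartsExhaust.RimCriterion

/-! ## §1 The four registered stubs (each over the bare clauses it consumes; no line-local definition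
appears in a stub signature, so a stub can be proved in a stand-alone `Theorems/` file importing only
`Summits.FinalStateConjecture.FinalStateConjecture.Statement`). The set
`⋃ j, d.chart j '' {x | (τ₀ ≤ tⱼ x ∨ τ₀ ≤ x⁰) ∧ R₀ ≤ rⱼ x ∧ rⱼ x ≤ Rⱼ(tⱼ x) ∧ tⱼ x ≤ τ₁}` of RIDE-ABLE
CERTIFIED TUBE POINTS (written out in each signature) is the interface between the stubs. -/

/-- **STUB 1 — RIM ENUMERATION** (card `rim-criterion`, "RIM"; triage form `(closure F ∩ O) \ F`).
Every point of `O` in the closure of the certified late region after `τ₁` but not in it lies on the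
certified slab at `τ₁` or is a ride-able certified tube point of some hole `j` (hole time `≤ τ₁`,
`R₀ ≤ rⱼ ≤ Rⱼ(tⱼ)`, hole-late or flat-late). Enumeration: `closure F = closure F₀ ∪ ⋃ⱼ closure Fⱼ`
(finite union); `closure F₀ ⊆ closure Φ''{τ₁ ≤ y⁰} ⊆` [SEAMED (11)] flat points with `y⁰ ≥ τ₁`
(`> τ₁`: in `F`; `= τ₁`: flat slab) or flat-tube WALL points `Ψⱼ x`, `x⁰ ≥ τ₁`, `rⱼ x = ρⱼ(x⁰) ≥ R₀`
[SEAMED (1)], `rⱼ + 2 ≤ Rⱼ(tⱼ x)` [SEAMED (8)] (`tⱼ x > τ₁`: in `Fⱼ`; else ride-able through the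
flat-late disjunct `τ₀ ≤ x⁰` — this covers the hole-EARLY/flat-late wall of the item's why-might-fail);
`closure Fⱼ ∩ O ⊆` [HonestCore (c) with the continuous profile `ϱ := Rⱼ`, `τ' := τ₁`]
`Ψⱼ''{τ₁ ≤ t, r ≤ Rⱼ(t)}` (`t > τ₁`: in `Fⱼ`; `t = τ₁`: hole disc). Size M−. -/
theorem stub_rim (𝓢 : Spacetime.{0} 4) (O : Set 𝓢.carrier) (d : FinalStateDecomposition 𝓢 O 2)
    (R : Fin d.N → ℝ → ℝ) (R₀ : ℝ)
    (hcl : ∀ i (τ' : ℝ) (ϱ : ℝ → ℝ), Continuous ϱ → d.τ₀ < τ' →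
      closure (d.chart i '' {x | τ' ≤ (d.background i).time x.1 ∧
        (d.background i).radius x.1 ≤ ϱ ((d.background i).time x.1)}) ∩ O ⊆
      d.chart i '' {x | τ' ≤ (d.background i).time x.1 ∧
        (d.background i).radius x.1 ≤ ϱ ((d.background i).time x.1)})
    (h1 : ∀ i, Continuous (R i) ∧ ∀ s, R₀ ≤ d.excision i s)
    (h8 : ∀ j (y : E4), d.τ₀ ≤ y 0 → (d.background j).radius y ≤ d.excision j (y 0) →
      (d.background j).radius y + 2 ≤ R j ((d.background j).time y))
    (h11 : ∀ τ' : ℝ, d.τ₀ < τ' → closure (d.flatChart '' {y | τ' ≤ y.1 0}) ⊆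
      d.flatChart '' {y | τ' ≤ y.1 0} ∪
        ⋃ j, d.chart j '' {x | τ' ≤ x.1 0 ∧ (d.background j).radius x.1 = d.excision j (x.1 0)})
    (τ₁ : ℝ) (hτ₁ : d.τ₀ < τ₁) :
    (closure (certifiedLate d R τ₁) ∩ O) \ certifiedLate d R τ₁ ⊆
      certifiedSlab d R τ₁ ∪ ⋃ j, d.chart j '' {x | (d.τ₀ ≤ (d.background j).time x.1 ∨ d.τ₀ ≤ x.1 0) ∧
        R₀ ≤ (d.background j).radius x.1 ∧
        (d.background j).radius x.1 ≤ R j ((d.background j).time x.1) ∧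
        (d.background j).time x.1 ≤ τ₁} := by
  sorry

/-- **STUB 2 — THE RIDE** (shared flow lemma of all six round-1 cards; `TubeRide`/`escalator`).
A ride-able certified tube point of hole `j` lies in `J⁻` of the certified slab at `τ₁`: along
`σ ↦ Ψⱼ(x + σ Λⱼe₀)`, `σ ∈ [0, τ₁ − tⱼ x]`, the rest-frame radius is constant (`poincareInv` is affine,
`Kerr.radius` is spatial), the hole clock rises at unit rate and the lab clock at rate `(Λⱼe₀)⁰ > 0`
(orthochronous, HonestCore (a)), so the segment stays in the chart domain and in the window of
SEAMED (5) (`R` monotone, SEAMED (1)); hence it is a future causal curve (velocity `dΨⱼ(Λⱼe₀)`,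
adapter `Disproof.line_mem_causalFuture`) ending on `truncTimeSlab (Rⱼ τ₁) τ₁ ⊆ certifiedSlab`. Size M. -/
theorem stub_tubeRide (𝓢 : Spacetime.{0} 4) (O : Set 𝓢.carrier) (d : FinalStateDecomposition 𝓢 O 2)
    (R : Fin d.N → ℝ → ℝ) (R₀ : ℝ)
    (horth : ∀ i, 0 < ((d.motion i).1 : E4 ≃L[ℝ] E4) (E4.basisVector 0) 0)
    (hmono : ∀ i, Monotone (R i))
    (h5 : ∀ i (x : (d.background i).domain),
      (d.τ₀ ≤ (d.background i).time x.1 ∨ d.τ₀ ≤ x.1 0) → R₀ ≤ (d.background i).radius x.1 →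
      (d.background i).radius x.1 ≤ R i ((d.background i).time x.1) →
      𝓢.timeOrientation.IsFutureDirected
        (mfderiv 𝓘(ℝ, E4) (𝓡 4) (d.chart i) x (((d.motion i).1 : E4 ≃L[ℝ] E4) (E4.basisVector 0))))
    (τ₁ : ℝ) :
    (⋃ j, d.chart j '' {x | (d.τ₀ ≤ (d.background j).time x.1 ∨ d.τ₀ ≤ x.1 0) ∧
        R₀ ≤ (d.background j).radius x.1 ∧
        (d.background j).radius x.1 ≤ R j ((d.background j).time x.1) ∧
        (d.background j).time x.1 ≤ τ₁}) ⊆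
      𝓢.metric.causalPast 𝓢.timeOrientation (certifiedSlab d R τ₁) := by
  sorry

/-- **STUB 3 — FLAT BOARDING** (REACH, flat case; card `anchor-and-board`'s first-contact form, preferred
by all three triagers). A flat-late point `Φ y` with `τ₀ < y⁰ ≤ τ₁` lies in `J⁻(S ∪ T)`, `T` the
ride-able certified tube points: follow the ray `σ ↦ y + σ e₀` on `[0, τ₁ − y⁰]`; the contact set
`{σ | ∃ k, rₖ ≤ Rₖ(tₖ)}` is closed (`R` continuous, SEAMED (1)); before first contact every
`rₖ > Rₖ(tₖ) − 2`, hence `rₖ > ρₖ(x⁰)` (SEAMED (8) contrapositive) and the ray is in `flatDomain`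
(structure field `setOf_lt_excision_subset_flatDomain`), where `dΦ(e₀)` is future-directed
(HonestCore (d)) — so `Φ y ≤ Φ u` at the contact point `u` (or at the flat slab if there is no contact);
at `u`: `rₖ u = Rₖ(tₖ u) ≥ R₀ + 4 > max r₊ 0` (`100 Mₖ ≤ R₀`), one atlas SEAMED (6) (`τ₀ ≤ u⁰`;
`∀ j, ρⱼ(u⁰) < rⱼ u` by (8) [`σ* > 0`] or (7) [`σ* = 0`]; `rₖ ≤ Rₖ + 1`) gives `Φ u = Ψₖ u`, and
`tₖ u ≤ u⁰ ≤ τ₁` by clock lag SEAMED (9) (or hole-earliness): `Ψₖ u ∈ T`. HARDEST stub (size M–L):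
first-contact infimum on `Icc`, continuity, the clamped coordinate-line adapter. -/
theorem stub_flatBoarding (𝓢 : Spacetime.{0} 4) (O : Set 𝓢.carrier)
    (d : FinalStateDecomposition 𝓢 O 2) (R : Fin d.N → ℝ → ℝ) (R₀ : ℝ)
    (ha : ∀ i, 100 * d.mass i ≤ R₀)
    (hd : ∀ y : d.flatDomain, d.τ₀ < y.1 0 →
      𝓢.timeOrientation.IsFutureDirected (mfderiv 𝓘(ℝ, E4) (𝓡 4) d.flatChart y (E4.basisVector 0)))
    (h1 : ∀ i, Continuous (R i) ∧ ∀ s, R₀ + 4 ≤ R i s ∧ R₀ ≤ d.excision i s)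
    (h6 : ∀ i (y : E4) (hy : y ∈ (d.background i).domain), d.τ₀ ≤ y 0 →
      (∀ j, d.excision j (y 0) < (d.background j).radius y) →
      (d.background i).radius y ≤ R i ((d.background i).time y) + 1 →
      ∃ hy' : y ∈ d.flatDomain, d.chart i ⟨y, hy⟩ = d.flatChart ⟨y, hy'⟩)
    (h7 : ∀ y : d.flatDomain, d.τ₀ ≤ y.1 0 → ∀ j, d.excision j (y.1 0) < (d.background j).radius y.1)
    (h8 : ∀ j (y : E4), d.τ₀ ≤ y 0 → (d.background j).radius y ≤ d.excision j (y 0) →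
      (d.background j).radius y + 2 ≤ R j ((d.background j).time y))
    (h9 : ∀ j (y : E4), d.τ₀ ≤ (d.background j).time y →
      (d.background j).radius y ≤ R j ((d.background j).time y) + 2 → (d.background j).time y ≤ y 0)
    (τ₁ : ℝ) (y : d.flatDomain) (hy₀ : d.τ₀ < y.1 0) (hy₁ : y.1 0 ≤ τ₁) :
    d.flatChart y ∈ 𝓢.metric.causalPast 𝓢.timeOrientation
      (certifiedSlab d R τ₁ ∪ ⋃ j, d.chart j '' {x | (d.τ₀ ≤ (d.background j).time x.1 ∨ d.τ₀ ≤ x.1 0) ∧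
        R₀ ≤ (d.background j).radius x.1 ∧
        (d.background j).radius x.1 ≤ R j ((d.background j).time x.1) ∧
        (d.background j).time x.1 ≤ τ₁}) := by
  sorry

/-- **STUB 4 — HOLE ROUTING** (REACH, hole case; flow-free enumeration). A hole-late point `Ψᵢ x`
(`tᵢ x > τ₀`) outside the certified late region after `τ₁` is (a) on the certified slab, or
(b) ANCHORABLE — `tᵢ x < τ₁` and `rᵢ x < Rᵢ(τ₁)` (then HonestCore (b) at `ϱ := Rᵢ(τ₁)` applies,
`hole_anchoring` below) —, or (c) equal to a flat-late point `Φ y` with `τ₀ < y⁰ ≤ τ₁` (then STUB 3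
applies). Cases: `r ≤ Rᵢ(t)`: `t > τ₁` ⇒ in `Fᵢ` (excluded), `t = τ₁` ⇒ disc, `t < τ₁` ⇒ (b) or collar;
COLLAR `Rᵢ(t) ≤ r ≤ Rᵢ(t) + 1` (incl. `t < τ₁ ≤` with `r ≥ Rᵢ(τ₁) ≥ Rᵢ(t)`, `R` monotone SEAMED (1)):
clock lag (9) gives `x⁰ ≥ t > τ₀`, (8) contrapositive gives `ρᵢ(x⁰) < rᵢ`, (12) then (8) give
`ρₖ(x⁰) < rₖ` for `k ≠ i`, so one atlas (6): `Ψᵢ x = Φ x`, flat time `x⁰ ≥ t` (`> τ₁` ⇒ in `F₀`,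
excluded; else (c)); FAR LEAF `r > Rᵢ(t) + 1`: SEAMED (10) puts `Ψᵢ x` in the radiation zone, `= Φ y`,
`y⁰ > τ₀` (`> τ₁` excluded; else (c)). Size M. -/
theorem stub_holeRouting (𝓢 : Spacetime.{0} 4) (O : Set 𝓢.carrier)
    (d : FinalStateDecomposition 𝓢 O 2) (R : Fin d.N → ℝ → ℝ) (R₀ : ℝ)
    (hmono : ∀ i, Monotone (R i))
    (h6 : ∀ i (y : E4) (hy : y ∈ (d.background i).domain), d.τ₀ ≤ y 0 →
      (∀ j, d.excision j (y 0) < (d.background j).radius y) →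
      (d.background i).radius y ≤ R i ((d.background i).time y) + 1 →
      ∃ hy' : y ∈ d.flatDomain, d.chart i ⟨y, hy⟩ = d.flatChart ⟨y, hy'⟩)
    (h8 : ∀ j (y : E4), d.τ₀ ≤ y 0 → (d.background j).radius y ≤ d.excision j (y 0) →
      (d.background j).radius y + 2 ≤ R j ((d.background j).time y))
    (h9 : ∀ j (y : E4), d.τ₀ ≤ (d.background j).time y →
      (d.background j).radius y ≤ R j ((d.background j).time y) + 2 → (d.background j).time y ≤ y 0)
    (h10 : ∀ j, d.chart j '' {x | d.τ₀ < (d.background j).time x.1 ∧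
      R j ((d.background j).time x.1) + 1 < (d.background j).radius x.1} ⊆ d.radiationZone)
    (h12 : ∀ j j' (y : E4), j ≠ j' → (d.τ₀ ≤ y 0 ∨ d.τ₀ ≤ (d.background j).time y) →
      (d.background j).radius y ≤ R j ((d.background j).time y) + 1 →
      R j' ((d.background j').time y) + 1 < (d.background j').radius y)
    (τ₁ : ℝ) (i : Fin d.N) (x : (d.background i).domain)
    (hlate : d.τ₀ < (d.background i).time x.1) (hF : d.chart i x ∉ certifiedLate d R τ₁) :
    d.chart i x ∈ certifiedSlab d R τ₁ ∨
      ((d.background i).time x.1 < τ₁ ∧ (d.background i).radius x.1 < R i τ₁) ∨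
      ∃ y : d.flatDomain, d.τ₀ < y.1 0 ∧ y.1 0 ≤ τ₁ ∧ d.chart i x = d.flatChart y := by
  sorry

/-! ## §2 Proved kernels (sorry-free) -/

section Kernels

variable {𝓢 : Spacetime.{0} 4}

/-- Smoothness index bookkeeping: `2 ≤ ∞` in `WithTop ℕ∞`. -/
theorem two_le_top : (2 : WithTop ℕ∞) ≤ ((⊤ : ℕ∞) : WithTop ℕ∞) := WithTop.coe_le_coe.mpr le_top

/-- `1 ≤ ∞` in `WithTop ℕ∞`. -/
theorem one_le_top : (1 : WithTop ℕ∞) ≤ ((⊤ : ℕ∞) : WithTop ℕ∞) := WithTop.coe_le_coe.mpr le_top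

/-- `J⁻` is transitive through a point: `x ≤ y`, `y ∈ J⁻ S` ⟹ `x ∈ J⁻ S`
(`causalFuture_causalFuture_eq` for the reversed orientation). O'Neill 1983, Ch. 14, p. 402. -/
theorem mem_causalPast_of_mem_causalPast_singleton {S : Set 𝓢.carrier} {x y : 𝓢.carrier}
    (hxy : x ∈ 𝓢.metric.causalPast 𝓢.timeOrientation {y})
    (hy : y ∈ 𝓢.metric.causalPast 𝓢.timeOrientation S) :
    x ∈ 𝓢.metric.causalPast 𝓢.timeOrientation S := by
  have h : x ∈ 𝓢.metric.causalFuture 𝓢.timeOrientation.reverse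
      (𝓢.metric.causalFuture 𝓢.timeOrientation.reverse S) :=
    LorentzianMetric.causalFuture_mono (singleton_subset_iff.mpr hy) hxy
  rwa [LorentzianMetric.causalFuture_causalFuture_eq two_le_top] at h

/-- `J⁻(J⁻ S) ⊆ J⁻ S`. O'Neill 1983, Ch. 14, p. 402. -/
theorem causalPast_causalPast_subset (S : Set 𝓢.carrier) :
    𝓢.metric.causalPast 𝓢.timeOrientation (𝓢.metric.causalPast 𝓢.timeOrientation S) ⊆
      𝓢.metric.causalPast 𝓢.timeOrientation S :=
  (LorentzianMetric.causalFuture_causalFuture_eq (τ := 𝓢.timeOrientation.reverse) two_le_top S).subset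

/-- **The rim criterion** (LEVER of the line; verbatim the ideator's `Ideate1.rimCriterion_holds`,
`SketchIdeator1.lean`, rc 0). In any spacetime, for sets `O, F, S`: if `O` is diamond-convex, every
point of `O` causally precedes a point of `O` lying in `F` or in `J⁻ S`, and `frontier F ∩ O ⊆ J⁻ S`,
then `O \ F ⊆ J⁻ S`. First entry of the causal curve into `closure F` (`sInf` over the closed set
`Icc a b ∩ γ⁻¹(closure F)`) is a frontier point (else interior, contradicting minimality, or `p ∈ F`),
lies in `O` by convexity, and `≤` composes into `J⁻ S`. -/
theorem rim_criterion (𝓢 : Spacetime.{0} 4) (O F S : Set 𝓢.carrier)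
    (hconv : ∀ p ∈ O, ∀ q ∈ O, 𝓢.metric.causalFuture 𝓢.timeOrientation {p} ∩
        𝓢.metric.causalPast 𝓢.timeOrientation {q} ⊆ O)
    (hreach : ∀ p ∈ O, ∃ q ∈ O, q ∈ 𝓢.metric.causalFuture 𝓢.timeOrientation {p} ∧
        (q ∈ F ∨ q ∈ 𝓢.metric.causalPast 𝓢.timeOrientation S))
    (hrim : frontier F ∩ O ⊆ 𝓢.metric.causalPast 𝓢.timeOrientation S) :
    O \ F ⊆ 𝓢.metric.causalPast 𝓢.timeOrientation S := by
  intro p hp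
  obtain ⟨hpO, hpF⟩ := hp
  -- transitivity of `≤` into `J⁻(S)`
  have htrans : ∀ {x y : 𝓢.carrier}, y ∈ 𝓢.metric.causalFuture 𝓢.timeOrientation {x} →
      y ∈ 𝓢.metric.causalPast 𝓢.timeOrientation S →
      x ∈ 𝓢.metric.causalPast 𝓢.timeOrientation S := fun hxy hyS ↦
    mem_causalPast_of_mem_causalPast_singleton (LorentzianMetric.mem_causalPast_singleton_iff.mpr hxy) hyS
  obtain ⟨q, hqO, hpq, hq⟩ := hreach p hpO
  rcases hq with hqF | hqS
  swap
  · exact htrans hpq hqS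
  -- `q ∈ F`: first entry of a causal curve from `p` to `q` into `closure F`
  rcases hpq with hqp | ⟨p', hp', γ, a, b, hab, hγ, hγa, hγb⟩
  · rw [mem_singleton_iff] at hqp
    exact absurd (hqp ▸ hqF) hpF
  rw [mem_singleton_iff] at hp'
  have hγa' : γ a = p := hγa.trans hp'
  have hcont : ContinuousOn γ (Icc a b) := fun t ht ↦ (hγ t ht).1.continuousAt.continuousWithinAt
  set T : Set ℝ := Icc a b ∩ γ ⁻¹' closure F with hT
  have hTc : IsClosed T := hcont.preimage_isClosed_of_isClosed isClosed_Icc isClosed_closure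
  have hbT : b ∈ T := ⟨right_mem_Icc.mpr hab.le, by
    show γ b ∈ closure F
    rw [hγb]; exact subset_closure hqF⟩
  have hTne : T.Nonempty := ⟨b, hbT⟩
  have hTbdd : BddBelow T := ⟨a, fun t ht ↦ ht.1.1⟩
  set t₀ := sInf T with ht₀
  have ht₀T : t₀ ∈ T := hTc.csInf_mem hTne hTbdd
  have hat₀ : a ≤ t₀ := ht₀T.1.1
  have ht₀b : t₀ ≤ b := ht₀T.1.2
  have hmin : ∀ t ∈ T, t₀ ≤ t := fun t ht ↦ csInf_le hTbdd ht
  set x := γ t₀ with hx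
  have hxcl : x ∈ closure F := ht₀T.2
  -- `x` is not an interior point of `F` unless `t₀ = a`, and then `p ∈ F`
  have hxfr : x ∈ frontier F := by
    refine ⟨hxcl, fun hint ↦ ?_⟩
    rcases hat₀.eq_or_lt with h | h
    · apply hpF
      rw [← hγa', h]
      exact interior_subset hint
    · have hct : ContinuousAt γ t₀ := (hγ t₀ ⟨hat₀, ht₀b⟩).1.continuousAt
      have hmem : γ ⁻¹' interior F ∈ 𝓝 t₀ := hct.preimage_mem_nhds (isOpen_interior.mem_nhds hint)
      rw [Metric.mem_nhds_iff] at hmem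
      obtain ⟨δ, hδ, hball⟩ := hmem
      set t := max a (t₀ - δ / 2) with htdef
      have hta : a ≤ t := le_max_left _ _
      have htt₀ : t < t₀ := max_lt h (by linarith)
      have htball : t ∈ Metric.ball t₀ δ := by
        rw [Metric.mem_ball, Real.dist_eq, abs_lt]
        constructor
        · have : t₀ - δ / 2 ≤ t := le_max_right _ _
          linarith
        · linarith
      have htT : t ∈ T := ⟨⟨hta, htt₀.le.trans ht₀b⟩, subset_closure (interior_subset (hball htball))⟩
      exact absurd (hmin t htT) (not_le.mpr htt₀)
  -- `x ∈ O` by diamond convexity: `p ≤ x ≤ q`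
  have hpx : x ∈ 𝓢.metric.causalFuture 𝓢.timeOrientation {p} := by
    rcases hat₀.eq_or_lt with h | h
    · left
      rw [mem_singleton_iff, hx, ← h, hγa']
    · exact Or.inr ⟨p, rfl, γ, a, t₀, h, hγ.mono (Icc_subset_Icc le_rfl ht₀b), hγa', rfl⟩
  have hxq : x ∈ 𝓢.metric.causalPast 𝓢.timeOrientation {q} := by
    refine LorentzianMetric.mem_causalPast_singleton_iff.mpr ?_
    rcases ht₀b.eq_or_lt with h | h
    · left
      rw [mem_singleton_iff, ← hγb, ← h]
    · exact Or.inr ⟨x, rfl, γ, t₀, b, h, hγ.mono (Icc_subset_Icc hat₀ le_rfl), rfl, hγb⟩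
  have hxO : x ∈ O := hconv p hpO q hqO ⟨hpx, hxq⟩
  exact htrans hpx (hrim ⟨hxfr, hxO⟩)

/-- Images of open subsets of the late region under a late chart are open (the restricted chart is
an open embedding). Copied from `SketchIdeator3.isOpen_image_of_isLateChart`. -/
theorem isOpen_image_of_isLateChart {B : ModelBackground} {𝒟 : Set 𝓢.carrier} {τ₀ : ℝ}
    {Ψ : B.domain → 𝓢.carrier} (hΨ : 𝓢.IsLateChart B 𝒟 τ₀ Ψ)
    {U : Set B.domain} (hU : IsOpen U) (hUl : U ⊆ B.lateRegion τ₀) : IsOpen (Ψ '' U) := by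
  have h := hΨ.isOpenEmbedding.isOpenMap (Subtype.val ⁻¹' U) (hU.preimage continuous_subtype_val)
  have hEq : (B.lateRegion τ₀).restrict Ψ '' (Subtype.val ⁻¹' U) = Ψ '' U := by
    ext z
    constructor
    · rintro ⟨⟨x, hxl⟩, hxU, rfl⟩
      exact ⟨x, hxU, rfl⟩
    · rintro ⟨x, hxU, rfl⟩
      exact ⟨⟨x, hUl hxU⟩, hxU, rfl⟩
  rw [← hEq]
  exact h

/-- **The certified late region is open** under SEAMED (1) [`R` continuous], (6), (8), (9), (12)
(verbatim the content of `SketchIdeator3.certifiedLateIsOpen_holds`, re-keyed to bare clauses):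
lateral walls `rⱼ = Rⱼ(tⱼ)`, `tⱼ > τ₁` are flat-late interior points by one atlas, whose hypotheses
follow from clock lag, margin 2 and disjointness; the rest is open embeddings of open sets. -/
theorem isOpen_certifiedLate {O : Set 𝓢.carrier} (d : FinalStateDecomposition 𝓢 O 2)
    (R : Fin d.N → ℝ → ℝ)
    (h1 : ∀ i, Continuous (R i))
    (h6 : ∀ i (y : E4) (hy : y ∈ (d.background i).domain), d.τ₀ ≤ y 0 →
      (∀ j, d.excision j (y 0) < (d.background j).radius y) →
      (d.background i).radius y ≤ R i ((d.background i).time y) + 1 →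
      ∃ hy' : y ∈ d.flatDomain, d.chart i ⟨y, hy⟩ = d.flatChart ⟨y, hy'⟩)
    (h8 : ∀ j (y : E4), d.τ₀ ≤ y 0 → (d.background j).radius y ≤ d.excision j (y 0) →
      (d.background j).radius y + 2 ≤ R j ((d.background j).time y))
    (h9 : ∀ j (y : E4), d.τ₀ ≤ (d.background j).time y →
      (d.background j).radius y ≤ R j ((d.background j).time y) + 2 → (d.background j).time y ≤ y 0)
    (h12 : ∀ j j' (y : E4), j ≠ j' → (d.τ₀ ≤ y 0 ∨ d.τ₀ ≤ (d.background j).time y) →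
      (d.background j).radius y ≤ R j ((d.background j).time y) + 1 →
      R j' ((d.background j').time y) + 1 < (d.background j').radius y)
    {τ₁ : ℝ} (hτ₁ : d.τ₀ < τ₁) : IsOpen (certifiedLate d R τ₁) := by
  -- continuity of the clocks and radii
  have hc0 : Continuous fun y : E4 ↦ y 0 := PiLp.continuous_apply 2 _ 0
  have ht : ∀ i, Continuous fun x : E4 ↦ (d.background i).time x := fun i ↦
    hc0.comp (continuous_poincareInv _ _)
  have hr : ∀ i, Continuous fun x : E4 ↦ (d.background i).radius x := fun i ↦
    (Kerr.continuous_radius _).comp (continuous_poincareInv _ _)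
  -- the open pieces
  have hF₀ : IsOpen (d.flatChart '' (Minkowski.backgroundOn d.flatDomain).lateRegion τ₁) := by
    refine isOpen_image_of_isLateChart d.isLateChart_flat ?_ fun y hy ↦ lt_trans hτ₁ hy
    exact isOpen_lt continuous_const (hc0.comp continuous_subtype_val)
  have hFi : ∀ i, IsOpen (d.chart i '' {x | τ₁ < (d.background i).time x.1 ∧
      (d.background i).radius x.1 < R i ((d.background i).time x.1)}) := by
    intro i
    refine isOpen_image_of_isLateChart (d.isLateChart i) ?_ fun x hx ↦ lt_trans hτ₁ hx.1
    exact (isOpen_lt continuous_const ((ht i).comp continuous_subtype_val)).and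
      (isOpen_lt ((hr i).comp continuous_subtype_val)
        ((h1 i).comp ((ht i).comp continuous_subtype_val)))
  -- `certifiedLate` is the union of the open pieces: lateral walls are flat-late
  have hEq : certifiedLate d R τ₁ =
      d.flatChart '' (Minkowski.backgroundOn d.flatDomain).lateRegion τ₁ ∪
        ⋃ i, d.chart i '' {x | τ₁ < (d.background i).time x.1 ∧
          (d.background i).radius x.1 < R i ((d.background i).time x.1)} := by
    refine Set.Subset.antisymm ?_ ?_
    · rintro z (hz | hz)
      · exact Or.inl hz
      · obtain ⟨j, x, ⟨hxt, hxr⟩, rfl⟩ := Set.mem_iUnion.mp hz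
        rcases lt_or_eq_of_le hxr with hlt | heq
        · exact Or.inr (Set.mem_iUnion.mpr ⟨j, x, ⟨hxt, hlt⟩, rfl⟩)
        · -- lateral wall point
          left
          have hτ₀t : d.τ₀ ≤ (d.background j).time x.1 := (lt_trans hτ₁ hxt).le
          have hlag : (d.background j).time x.1 ≤ x.1 0 := h9 j x.1 hτ₀t (by linarith)
          have hτ₀y : d.τ₀ ≤ x.1 0 := by linarith
          have hout : ∀ k, d.excision k (x.1 0) < (d.background k).radius x.1 := by
            intro k
            by_contra hk
            push Not at hk
            have h8' : (d.background k).radius x.1 + 2 ≤ R k ((d.background k).time x.1) :=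
              h8 k x.1 hτ₀y hk
            rcases eq_or_ne k j with rfl | hkj
            · linarith
            · have h12' : R k ((d.background k).time x.1) + 1 < (d.background k).radius x.1 :=
                h12 j k x.1 (Ne.symm hkj) (Or.inl hτ₀y) (by linarith)
              linarith
          obtain ⟨hy', hEqΦ⟩ := h6 j x.1 x.2 hτ₀y hout (by linarith)
          refine ⟨⟨x.1, hy'⟩, ?_, ?_⟩
          · show τ₁ < x.1 0
            linarith
          · rw [← hEqΦ]
    · rintro z (hz | hz)
      · exact Or.inl hz
      · obtain ⟨j, x, ⟨hxt, hxr⟩, rfl⟩ := Set.mem_iUnion.mp hz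
        exact Or.inr (Set.mem_iUnion.mpr ⟨j, x, ⟨hxt, hxr.le⟩, rfl⟩)
  rw [hEq]
  exact hF₀.union (isOpen_iUnion hFi)

/-- **Hole anchoring at the slab radius** (HonestCore (b) at `ϱ := Rᵢ(τ₁) ≥ R₀`, `τ₂ := τ₁`; the
proved lever of cards `wide-anchoring`/`anchor-and-board`): a hole-late point with hole time `< τ₁`
and radius `< Rᵢ(τ₁)` lies in `J⁻` of the certified slab at `τ₁`. -/
theorem hole_anchoring {O : Set 𝓢.carrier} (d : FinalStateDecomposition 𝓢 O 2)
    (R : Fin d.N → ℝ → ℝ) (R₀ : ℝ)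
    (hb : ∀ i (ϱ τ₂ : ℝ), R₀ ≤ ϱ → d.τ₀ < τ₂ →
      d.chart i '' {x | d.τ₀ < (d.background i).time x.1 ∧ (d.background i).time x.1 < τ₂ ∧
        (d.background i).radius x.1 < ϱ} ⊆
        𝓢.metric.causalPast 𝓢.timeOrientation (d.chart i '' (d.background i).truncTimeSlab ϱ τ₂))
    (hR : ∀ i s, R₀ ≤ R i s) {τ₁ : ℝ} (hτ₁ : d.τ₀ < τ₁) (i : Fin d.N)
    (x : (d.background i).domain) (ht₀ : d.τ₀ < (d.background i).time x.1)
    (ht₁ : (d.background i).time x.1 < τ₁) (hr : (d.background i).radius x.1 < R i τ₁) :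
    d.chart i x ∈ 𝓢.metric.causalPast 𝓢.timeOrientation (certifiedSlab d R τ₁) := by
  have h := hb i (R i τ₁) τ₁ (hR i τ₁) hτ₁ ⟨x, ⟨ht₀, ht₁, hr⟩, rfl⟩
  refine LorentzianMetric.causalFuture_mono ?_ h
  intro z hz
  exact Set.mem_union_right _ (Set.mem_iUnion.mpr ⟨i, hz⟩)


/-- **Coordinate lines through a chart are causal curves** (the ADAPTER both flow stubs need; verbatim
the disprover's `Disproof.line_mem_causalFuture`, §4 of `Cruxes/SeamedChartsExhaust/Disproof.lean`, proved).
Let `Φ : U → 𝓢` be smooth on an open `U ⊆ E4`, `v ∈ E4`, and suppose the segment `σ ↦ y + σ v`,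
`σ ∈ [−ε, s + ε]`, lies in `U` and `dΦ(v)` is future-directed causal along `σ ∈ [0, s]`. Then
`Φ(y) ≤ Φ(y + s v)`. (The parameter is clamped to `[−ε, s + ε]` to obtain a globally defined curve that is
differentiable on the CLOSED interval `[0, s]`, as `IsFutureCausalCurveOn` demands.) Use: `stub_tubeRide`
with `U = boostedKerrExterior`, `v = Λⱼe₀` (any `ε`: the radius is constant in `σ`); `stub_flatBoarding` with
`U = d.flatDomain`, `v = e₀` (`ε` from openness of `U` at the two endpoints). O'Neill 1983, Ch. 14, p. 402. -/
theorem line_mem_causalFuture {U : Opens E4} {Φ : U → 𝓢.carrier}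
    (hΦ : ContMDiff 𝓘(ℝ, E4) (𝓡 4) ∞ Φ) (v y : E4) (hy : y ∈ U) {s ε : ℝ} (hs : 0 ≤ s) (hε : 0 < ε)
    (hmem : ∀ σ ∈ Icc (-ε) (s + ε), y + σ • v ∈ U)
    (hfut : ∀ z : U, z.1 ∈ (fun σ : ℝ ↦ y + σ • v) '' Icc 0 s →
      𝓢.timeOrientation.IsFutureDirected (mfderiv 𝓘(ℝ, E4) (𝓡 4) Φ z v)) :
    Φ ⟨y + s • v, hmem s ⟨by linarith, by linarith⟩⟩ ∈
      𝓢.metric.causalFuture 𝓢.timeOrientation {Φ ⟨y, hy⟩} := by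
  rcases hs.eq_or_lt with hs0 | hs'
  · subst hs0
    have : (⟨y + (0 : ℝ) • v, hmem 0 ⟨by linarith, by linarith⟩⟩ : U) = ⟨y, hy⟩ := Subtype.ext (by simp)
    rw [this]
    exact Or.inl rfl
  -- clamp the parameter
  set c : ℝ → ℝ := fun σ ↦ max (-ε) (min σ (s + ε)) with hc
  have hcmem : ∀ σ, c σ ∈ Icc (-ε) (s + ε) := fun σ ↦
    ⟨le_max_left _ _, max_le (by linarith) (min_le_right _ _)⟩
  have hcid : ∀ σ ∈ Ioo (-ε) (s + ε), c σ = σ := fun σ hσ ↦ by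
    simp only [hc]
    rw [min_eq_left hσ.2.le, max_eq_right hσ.1.le]
  set ι : ℝ → U := fun σ ↦ ⟨y + c σ • v, hmem (c σ) (hcmem σ)⟩ with hι
  have hιval : ∀ σ, (ι σ).1 = y + c σ • v := fun σ ↦ rfl
  set γ : ℝ → 𝓢.carrier := fun σ ↦ Φ (ι σ) with hγ
  have hι0 : ι 0 = ⟨y, hy⟩ := Subtype.ext (by
    rw [hιval, hcid 0 ⟨by linarith, by linarith⟩]; simp)
  have hιs : ι s = ⟨y + s • v, hmem s ⟨by linarith, by linarith⟩⟩ := Subtype.ext (by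
    rw [hιval, hcid s ⟨by linarith, by linarith⟩])
  refine Or.inr ⟨Φ ⟨y, hy⟩, rfl, γ, 0, s, hs', ?_, ?_, ?_⟩
  · intro t ht
    have htI : t ∈ Ioo (-ε) (s + ε) := ⟨by linarith [ht.1], by linarith [ht.2]⟩
    have hev : ∀ᶠ σ in 𝓝 t, c σ = σ :=
      Filter.eventually_of_mem (isOpen_Ioo.mem_nhds htI) fun σ hσ ↦ hcid σ hσ
    have hval : (Subtype.val ∘ ι) =ᶠ[𝓝 t] fun σ : ℝ ↦ y + σ • v :=
      hev.mono fun σ hσ ↦ by simp only [Function.comp_apply, hιval, hσ]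
    have haff : ContMDiff 𝓘(ℝ, ℝ) 𝓘(ℝ, E4) ∞ (fun σ : ℝ ↦ y + σ • v) :=
      (contDiff_const.add (contDiff_id.smul contDiff_const)).contMDiff
    have hιs' : ContMDiffAt 𝓘(ℝ, ℝ) 𝓘(ℝ, E4) ∞ ι t := by
      rw [← ContMDiffAt.subtypeVal_comp_iff]
      exact haff.contMDiffAt.congr_of_eventuallyEq hval
    have hιd : MDifferentiableAt 𝓘(ℝ, ℝ) 𝓘(ℝ, E4) ι t := hιs'.mdifferentiableAt (by simp)
    have hΦd : MDifferentiableAt 𝓘(ℝ, E4) (𝓡 4) Φ (ι t) := hΦ.mdifferentiableAt (by simp)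
    have hγd : MDifferentiableAt 𝓘(ℝ, ℝ) (𝓡 4) γ t := hΦd.comp t hιd
    -- the velocity of `ι` is `v`
    have hder : HasDerivAt (fun σ : ℝ ↦ y + σ • v) v t := by
      simpa using ((hasDerivAt_id t).smul_const v).const_add y
    have h3 : mfderiv 𝓘(ℝ, ℝ) 𝓘(ℝ, E4) (fun σ : ℝ ↦ y + σ • v) t (1 : ℝ) = v := by
      rw [mfderiv_eq_fderiv]
      change fderiv ℝ (fun σ : ℝ ↦ y + σ • v) t 1 = v
      rw [hder.hasFDerivAt.fderiv]
      simp
    have hvι : mfderiv 𝓘(ℝ, ℝ) 𝓘(ℝ, E4) ι t (1 : ℝ) = v := by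
      have h1 : mfderiv 𝓘(ℝ, ℝ) 𝓘(ℝ, E4) (Subtype.val ∘ ι) t =
          (mfderiv 𝓘(ℝ, E4) 𝓘(ℝ, E4) (Subtype.val : U → E4) (ι t)).comp
            (mfderiv 𝓘(ℝ, ℝ) 𝓘(ℝ, E4) ι t) :=
        mfderiv_comp t
          ((contMDiff_subtype_val : ContMDiff 𝓘(ℝ, E4) 𝓘(ℝ, E4) ∞ (Subtype.val : U → E4)).mdifferentiableAt
            (by simp)) hιd
      have h2 : mfderiv 𝓘(ℝ, ℝ) 𝓘(ℝ, E4) (Subtype.val ∘ ι) t =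
          mfderiv 𝓘(ℝ, ℝ) 𝓘(ℝ, E4) (fun σ : ℝ ↦ y + σ • v) t := hval.mfderiv_eq
      have h4 : (mfderiv 𝓘(ℝ, E4) 𝓘(ℝ, E4) (Subtype.val : U → E4) (ι t))
          ((mfderiv 𝓘(ℝ, ℝ) 𝓘(ℝ, E4) ι t) (1 : ℝ)) =
          (mfderiv 𝓘(ℝ, ℝ) 𝓘(ℝ, E4) (fun σ : ℝ ↦ y + σ • v) t) (1 : ℝ) := by
        have := congrArg (fun L ↦ L (1 : ℝ)) h1
        rw [h2] at this
        exact this.symm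
      rw [h3, OpensChart.mfderiv_subtypeVal_apply] at h4
      exact h4
    have hvel : velocity (𝓡 4) γ t = mfderiv 𝓘(ℝ, E4) (𝓡 4) Φ (ι t) v := by
      unfold velocity
      rw [show γ = Φ ∘ ι from rfl, mfderiv_comp t hΦd hιd]
      show (mfderiv 𝓘(ℝ, E4) (𝓡 4) Φ (ι t)) ((mfderiv 𝓘(ℝ, ℝ) 𝓘(ℝ, E4) ι t) (1 : ℝ)) = _
      rw [hvι]
    refine ⟨hγd, ?_⟩
    rw [hvel]
    refine hfut (ι t) ⟨c t, ?_, (hιval t).symm⟩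
    rw [hcid t htI]
    exact ht
  · show Φ (ι 0) = Φ ⟨y, hy⟩
    rw [hι0]
  · show Φ (ι s) = Φ ⟨y + s • v, hmem s ⟨by linarith, by linarith⟩⟩
    rw [hιs]

end Kernels

section Exterior

variable {X : Type} [TopologicalSpace X] [ChartedSpace E3 X] [IsManifold (𝓡 3) ∞ X]
  [ConnectedSpace X] {D : InitialDataSet (𝓡 3) X}

/-- (E1) COFINALITY of the route's exterior: `exteriorOf 𝒟 U ⊆ I⁻(U)` (second intersectand). -/
theorem exteriorOf_cofinal (𝒟 : CauchyDevelopment D) (U : Set 𝒟.carrier) :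
    exteriorOf 𝒟 U ⊆ 𝒟.metric.chronologicalPast 𝒟.timeOrientation U :=
  inter_subset_right

/-- (E2) DIAMOND CONVEXITY of the route's exterior: `J⁺(p) ∩ J⁻(q) ⊆ exteriorOf 𝒟 U` for `p, q`
in it (transitivity of `J⁺` and push-up `x ≤ q ≪ m ⇒ x ≪ m`; verbatim `Ideate1.exteriorOf_diamond`). -/
theorem exteriorOf_diamond (𝒟 : CauchyDevelopment D) (U : Set 𝒟.carrier)
    {p q : 𝒟.carrier} (hp : p ∈ exteriorOf 𝒟 U) (hq : q ∈ exteriorOf 𝒟 U) :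
    𝒟.metric.causalFuture 𝒟.timeOrientation {p} ∩ 𝒟.metric.causalPast 𝒟.timeOrientation {q} ⊆
      exteriorOf 𝒟 U := by
  rintro x ⟨hxp, hxq⟩
  refine ⟨?_, ?_⟩
  · -- `Σ ≤ p ≤ x`
    have h1 : x ∈ 𝒟.metric.causalFuture 𝒟.timeOrientation
        (𝒟.metric.causalFuture 𝒟.timeOrientation (range 𝒟.embed)) :=
      LorentzianMetric.causalFuture_mono (singleton_subset_iff.mpr hp.1) hxp
    rwa [LorentzianMetric.causalFuture_causalFuture_eq two_le_top] at h1
  · -- `x ≤ q ≪ m ⟹ x ≪ m`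
    obtain ⟨m, hm, γ, a, b, hab, hγ, hγa, hγb⟩ := hq.2
    have hqm : q ∈ 𝒟.metric.chronologicalPast 𝒟.timeOrientation {m} :=
      ⟨m, rfl, γ, a, b, hab, hγ, hγa, hγb⟩
    have h1 : q ∈ 𝒟.metric.causalFuture 𝒟.timeOrientation {x} :=
      LorentzianMetric.mem_causalPast_singleton_iff.mp hxq
    have h2 : m ∈ 𝒟.metric.chronologicalFuture 𝒟.timeOrientation {q} :=
      LorentzianMetric.mem_chronologicalFuture_of_mem_chronologicalPast hqm
    have h3 : m ∈ 𝒟.metric.chronologicalFuture 𝒟.timeOrientation {x} :=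
      LorentzianMetric.mem_chronologicalFuture_of_mem_causalFuture one_le_top h1 h2
    have h4 : x ∈ 𝒟.metric.chronologicalPast 𝒟.timeOrientation {m} :=
      LorentzianMetric.mem_chronologicalPast_of_mem_chronologicalFuture h3
    exact LorentzianMetric.chronologicalFuture_mono (g := 𝒟.metric)
      (τ := 𝒟.timeOrientation.reverse) (singleton_subset_iff.mpr hm) h4

end Exterior

/-! ## §3 Assembly: exhaustion from the parts (spacetime level), then the crux by name -/

section Assembly

variable {𝓢 : Spacetime.{0} 4} {O : Set 𝓢.carrier}

/-- **Exhaustion from the parts.** For a decomposition `d` of a region `O` that is cofinal under the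
charts (E1) and diamond-convex (E2), clause (i), openness of the certified late regions, and — with an
arbitrary family of LANDING SETS `T τ₁ ⊆ J⁻(certifiedSlab τ₁)` — hole anchoring, flat boarding into
`J⁻(S ∪ T)`, hole routing and the rim enumeration into `S ∪ T` imply `HasExhaustiveCharts d`.
(Pure causality: `rim_criterion`, `J⁻ ∘ J⁻ = J⁻`, `I⁻ ⊆ J⁻`.) -/
theorem hasExhaustiveCharts_of_parts (d : FinalStateDecomposition 𝓢 O 2) (R : Fin d.N → ℝ → ℝ)
    (T : ℝ → Set 𝓢.carrier)
    (hE1 : O ⊆ 𝓢.metric.chronologicalPast 𝓢.timeOrientation d.charted)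
    (hE2 : ∀ p ∈ O, ∀ q ∈ O, 𝓢.metric.causalFuture 𝓢.timeOrientation {p} ∩
        𝓢.metric.causalPast 𝓢.timeOrientation {q} ⊆ O)
    (hi : ∀ i, Tendsto (fun τ ↦ 𝓢.truncDeviationCk (d.background i) (d.chart i) 2 (R i τ) τ)
      atTop (𝓝 0))
    (hopen : ∀ τ₁, d.τ₀ < τ₁ → IsOpen (certifiedLate d R τ₁))
    (hT : ∀ τ₁, d.τ₀ < τ₁ → T τ₁ ⊆ 𝓢.metric.causalPast 𝓢.timeOrientation (certifiedSlab d R τ₁))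
    (hanchor : ∀ τ₁, d.τ₀ < τ₁ → ∀ (i : Fin d.N) (x : (d.background i).domain),
      d.τ₀ < (d.background i).time x.1 → (d.background i).time x.1 < τ₁ →
      (d.background i).radius x.1 < R i τ₁ →
      d.chart i x ∈ 𝓢.metric.causalPast 𝓢.timeOrientation (certifiedSlab d R τ₁))
    (hboard : ∀ τ₁, d.τ₀ < τ₁ → ∀ y : d.flatDomain, d.τ₀ < y.1 0 → y.1 0 ≤ τ₁ →
      d.flatChart y ∈ 𝓢.metric.causalPast 𝓢.timeOrientation (certifiedSlab d R τ₁ ∪ T τ₁))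
    (hroute : ∀ τ₁, d.τ₀ < τ₁ → ∀ (i : Fin d.N) (x : (d.background i).domain),
      d.τ₀ < (d.background i).time x.1 → d.chart i x ∉ certifiedLate d R τ₁ →
      d.chart i x ∈ certifiedSlab d R τ₁ ∨
        ((d.background i).time x.1 < τ₁ ∧ (d.background i).radius x.1 < R i τ₁) ∨
        ∃ y : d.flatDomain, d.τ₀ < y.1 0 ∧ y.1 0 ≤ τ₁ ∧ d.chart i x = d.flatChart y)
    (hrim : ∀ τ₁, d.τ₀ < τ₁ → (closure (certifiedLate d R τ₁) ∩ O) \ certifiedLate d R τ₁ ⊆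
      certifiedSlab d R τ₁ ∪ T τ₁) :
    HasExhaustiveCharts d := by
  refine ⟨R, hi, fun τ₁ hτ₁ ↦ ?_⟩
  -- `J⁻` bookkeeping for the landing sets
  have hSJ : certifiedSlab d R τ₁ ⊆ 𝓢.metric.causalPast 𝓢.timeOrientation (certifiedSlab d R τ₁) :=
    LorentzianMetric.subset_causalPast _ _ _
  have hST : certifiedSlab d R τ₁ ∪ T τ₁ ⊆
      𝓢.metric.causalPast 𝓢.timeOrientation (certifiedSlab d R τ₁) :=
    union_subset hSJ (hT τ₁ hτ₁)
  have hJST : 𝓢.metric.causalPast 𝓢.timeOrientation (certifiedSlab d R τ₁ ∪ T τ₁) ⊆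
      𝓢.metric.causalPast 𝓢.timeOrientation (certifiedSlab d R τ₁) :=
    (LorentzianMetric.causalFuture_mono hST).trans (causalPast_causalPast_subset _)
  -- REACH, flat case
  have hflat : ∀ y : d.flatDomain, d.τ₀ < y.1 0 → d.flatChart y ∉ certifiedLate d R τ₁ →
      d.flatChart y ∈ 𝓢.metric.causalPast 𝓢.timeOrientation (certifiedSlab d R τ₁) := by
    intro y hy hyF
    have hy₁ : y.1 0 ≤ τ₁ := not_lt.mp fun h ↦ hyF (Or.inl ⟨y, h, rfl⟩)
    exact hJST (hboard τ₁ hτ₁ y hy hy₁)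
  -- REACH: every charted point outside `F` drains
  have hreach : d.charted \ certifiedLate d R τ₁ ⊆
      𝓢.metric.causalPast 𝓢.timeOrientation (certifiedSlab d R τ₁) := by
    rintro q ⟨hq, hqF⟩
    rcases hq with ⟨y, hy, rfl⟩ | hq
    · exact hflat y hy hqF
    · obtain ⟨i, x, hx, rfl⟩ := mem_iUnion.mp hq
      rcases hroute τ₁ hτ₁ i x hx hqF with hS | ⟨ht, hr⟩ | ⟨y, hy₀, hy₁, hEq⟩
      · exact hSJ hS
      · exact hanchor τ₁ hτ₁ i x hx ht hr
      · rw [hEq]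
        exact hJST (hboard τ₁ hτ₁ y hy₀ hy₁)
  -- RIM: the frontier of the open set `F` inside `O` drains
  have hfr : frontier (certifiedLate d R τ₁) ∩ O ⊆
      𝓢.metric.causalPast 𝓢.timeOrientation (certifiedSlab d R τ₁) := by
    rintro z ⟨hz, hzO⟩
    rw [(hopen τ₁ hτ₁).frontier_eq] at hz
    exact hST (hrim τ₁ hτ₁ ⟨⟨hz.1, hzO⟩, hz.2⟩)
  -- the rim criterion
  refine rim_criterion 𝓢 O (certifiedLate d R τ₁) (certifiedSlab d R τ₁) hE2 ?_ hfr
  intro p hp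
  have hpI : p ∈ 𝓢.metric.chronologicalFuture 𝓢.timeOrientation.reverse d.charted := hE1 hp
  rw [LorentzianMetric.chronologicalFuture_eq_biUnion] at hpI
  simp only [mem_iUnion, exists_prop] at hpI
  obtain ⟨c, hc, hpc⟩ := hpI
  have hcp : c ∈ 𝓢.metric.causalFuture 𝓢.timeOrientation {p} :=
    LorentzianMetric.chronologicalFuture_subset_causalFuture _ _ _
      (LorentzianMetric.mem_chronologicalFuture_of_mem_chronologicalPast hpc)
  refine ⟨c, d.charted_subset hc, hcp, ?_⟩
  by_cases hcF : c ∈ certifiedLate d R τ₁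
  · exact Or.inl hcF
  · exact Or.inr (hreach ⟨hc, hcF⟩)

end Assembly

/-- **COMPOSITION — the crux BY NAME from the four stubs.** `O = exteriorOf 𝒟 d.charted` supplies
(E1), (E2); HonestCore/SEAMED are destructured into the bare clauses the stubs and kernels consume;
the landing sets are the ride-able certified tube points, drained by `stub_tubeRide`. Sorry-free apart
from the four `stub_*` it invokes. -/
theorem SeamedChartsExhaust_of :
    _root_.Summit.FinalStateConjecture.FinalStateConjecture.Theses.StarvedNecks.SeamedChartsExhaust := by
  intro X _ _ _ _ D hD 𝒟 h𝒟 O d R R₀ hO hc hs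
  obtain ⟨ha, hb, hcc, hd⟩ := hc
  obtain ⟨h1, h2, -, -, h5, h6, h7, h8, h9, h10, h11, h12⟩ := hs
  refine hasExhaustiveCharts_of_parts d R
    (fun τ₁ ↦ ⋃ j, d.chart j '' {x | (d.τ₀ ≤ (d.background j).time x.1 ∨ d.τ₀ ≤ x.1 0) ∧
        R₀ ≤ (d.background j).radius x.1 ∧
        (d.background j).radius x.1 ≤ R j ((d.background j).time x.1) ∧
        (d.background j).time x.1 ≤ τ₁})
    ?_ ?_ h2 ?_ ?_ ?_ ?_ ?_ ?_
  · -- (E1) cofinality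
    intro p hp
    rw [hO] at hp
    exact exteriorOf_cofinal 𝒟.toCauchyDevelopment d.charted hp
  · -- (E2) diamond convexity
    intro p hp q hq x hx
    rw [hO] at hp hq ⊢
    exact exteriorOf_diamond 𝒟.toCauchyDevelopment d.charted hp hq hx
  · -- openness of the certified late regions
    exact fun τ₁ hτ₁ ↦ isOpen_certifiedLate d R (fun i ↦ (h1 i).2.1) h6 h8 h9 h12 hτ₁
  · -- the ride drains the landing sets (STUB 2)
    exact fun τ₁ _ ↦ stub_tubeRide 𝒟.toSpacetime O d R R₀ (fun i ↦ (ha i).2.2) (fun i ↦ (h1 i).1) h5 τ₁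
  · -- hole anchoring (HonestCore (b) at `ϱ := Rᵢ(τ₁)`)
    exact fun τ₁ hτ₁ i x ht₀ ht₁ hr ↦ hole_anchoring d R R₀ hb
      (fun i s ↦ by linarith [((h1 i).2.2 s).1]) hτ₁ i x ht₀ ht₁ hr
  · -- flat boarding (STUB 3)
    exact fun τ₁ _ y hy₀ hy₁ ↦ stub_flatBoarding 𝒟.toSpacetime O d R R₀ (fun i ↦ (ha i).2.1) hd
      (fun i ↦ ⟨(h1 i).2.1, (h1 i).2.2⟩) h6 h7 h8 h9 τ₁ y hy₀ hy₁
  · -- hole routing (STUB 4)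
    exact fun τ₁ _ i x hlate hF ↦ stub_holeRouting 𝒟.toSpacetime O d R R₀ (fun i ↦ (h1 i).1) h6 h8 h9 h10 h12
      τ₁ i x hlate hF
  · -- rim enumeration (STUB 1)
    exact fun τ₁ hτ₁ ↦ stub_rim 𝒟.toSpacetime O d R R₀ hcc (fun i ↦ ⟨(h1 i).2.1, fun s ↦ ((h1 i).2.2 s).2⟩)
      h8 h11 τ₁ hτ₁

/-! ## §4 Negative check (landed `Theorems/SeamedChartsExhaust/Negative/*`, cdisprove §3)

HonestCore (d) cannot be dropped (`Negative.not_forall_hasExhaustiveCharts_without_futureOrientation`,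
`Negative/WithoutFutureOrientation.lean`; model `ReversedModel.decomp` with
`ReversedModel.not_hasExhaustiveCharts_decomp`, `Negative/ReversedFlatChart.lean`, referenced below): in the
time-reversed flat chart on Minkowski spacetime every other clause holds and exhaustion fails. Of the
four stubs only `stub_flatBoarding` consumes (d) (`hd`); in
that model `stub_rim` (`N = 0`: closure `{x⁰ ≤ −1}` minus `{x⁰ < −1}` is the flat slab), `stub_tubeRide`
and `stub_holeRouting` (no holes) hold, and `stub_flatBoarding` is exactly what fails — as it must. -/

example : True := by
  have _neg :=
    @_root_.Summit.FinalStateConjecture.FinalStateConjecture.Theorems.SeamedChartsExhaust.Negative.ReversedModel.not_hasExhaustiveCharts_decomp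
  trivial

end Summit.FinalStateConjecture.FinalStateConjecture.Cruxes.SeamedChartsExhaust.RimCriterion

end
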